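import Literature.NumberTheory.Transcendental.KZHyperbolicLadder
import Literature.NumberTheory.Transcendental.KZIdealTetrahedron
import Summits.KontsevichZagierPeriods.KontsevichZagierPeriods.Theorems.HyperbolicBlochFiveTermTransferStubFiveTermIndicator

/-!
# `OffTetraSectorKernel` (stmt-KontsevichZagierPeriods-10557) — line `odd-hyperbolic-ladder` (skeleton v3b):
the `ℚ̄`-tetrahedron sector lies in rung 2 of the hyperbolic ladder

Lead c2. Bridge to lead c1's ladder vocabulary (`Literature/…/KZHyperbolicLadder.lean`): an admissible lifted simplex
`Spx v` (rows real algebraic, `det v ≠ 0`) on which the volume density `t⁻³ = KZ.hypDensity 2` is integrable IS a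
`ℚ̄`-geodesic polytope of `ℍ³` (`KZ.IsGeodesicPolytope 2`): each face `{D · E_a > 0}` is the vertical plane
`C₁p₀ + C₂p₁ + C₃ = 0` when the cofactor `C₀` of `|p|²` in `E_a` vanishes, and the hemisphere centred at
`(−C₁/2C₀, −C₂/2C₀, 0)` of squared radius `(C₁/2C₀)² + (C₂/2C₀)² − C₃/C₀` otherwise (side `ε = sign(D C₀)`), all
parameters real algebraic (determinants of algebraic matrices, `bridge_isAlgebraic_det`). So the simplex sector absorbed by
`simplexRelators_le` (`…RedAll.lean`) is a sub-sector of `KZ.rungRelators 2`; the converse containment is the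
triangulation of `ℚ̄`-polyhedra (crux idea `triangulate-rung-two`). [Dupont–Sah 1982 §2; Goncharov 1999 §1.1]
-/

noncomputable section
open Set MeasureTheory Literature.NumberTheory.Transcendental

namespace Summit.KontsevichZagierPeriods.HyperbolicBloch.OffTetraSectorKernel

/-- The determinant of a matrix with real-algebraic entries is real algebraic. [folklore] -/
theorem bridge_isAlgebraic_det {n : Type*} [Fintype n] [DecidableEq n] (M : Matrix n n ℝ)
    (hM : ∀ i j, IsAlgebraic ℚ (M i j)) : IsAlgebraic ℚ M.det := by
  -- lift the matrix to the integral closure of ℚ in ℝ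
  have hint : ∀ i j, IsIntegral ℚ (M i j) := fun i j => (hM i j).isIntegral
  let M' : Matrix n n (integralClosure ℚ ℝ) := Matrix.of fun i j => ⟨M i j, hint i j⟩
  have hmap : (algebraMap (integralClosure ℚ ℝ) ℝ).mapMatrix M' = M := by
    ext i j; rfl
  have : M.det = algebraMap (integralClosure ℚ ℝ) ℝ M'.det := by
    rw [← hmap, RingHom.map_det]
  rw [this]
  exact (M'.det.2).isAlgebraic |>.algebraMap

/-- **The simplex sector lies in rung 2**: an admissible lifted simplex on which `t⁻³` is integrable is a `ℚ̄`-geodesic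
polytope of `ℍ³` in the sense of `KZ.IsGeodesicPolytope 2`: the face `{D · E_a > 0}` is the vertical plane
`C₁p₀ + C₂p₁ + C₃ = 0` when the cofactor `C₀` of `|p|²` vanishes, and the hemisphere centred at `(−C₁/2C₀, −C₂/2C₀, 0)`
otherwise (all cofactors algebraic). [folklore] -/
theorem bridge_spx_isGeodesicPolytope :
    ∀ (Ql : (Fin 3 → ℝ) → Fin 4 → ℝ)
    (hQl : ∀ p, Ql p = ![p 0 ^ 2 + p 1 ^ 2 + p 2 ^ 2, p 0, p 1, 1])
    (Spx : (Fin 4 → Fin 4 → ℝ) → Set (Fin 3 → ℝ))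
    (hSpx : ∀ v, Spx v = {p | 0 < p 2 ∧ ∀ a, 0 < (Matrix.of v).det * ((Matrix.of v).updateRow a (Ql p)).det})
    (v : Fin 4 → Fin 4 → ℝ) (hvalg : ∀ i k, IsAlgebraic ℚ (v i k)) (hdet : (Matrix.of v).det ≠ 0)
    (hint : IntegrableOn (KZ.hypDensity 2) (Spx v)),
    KZ.IsGeodesicPolytope 2 (Spx v) := by
  intro Ql hQl Spx hSpx v hvalg hdet hint
  classical
  set D : ℝ := (Matrix.of v).det with hD
  -- cofactors: E_a(p) = Q 0 * C a 0 + Q 1 * C a 1 + Q 2 * C a 2 + Q 3 * C a 3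
  set C : Fin 4 → Fin 4 → ℝ := fun a b => ((Matrix.of v).updateRow a (Pi.single b 1)).det with hC
  have hEC : ∀ (p : Fin 3 → ℝ) (a : Fin 4), ((Matrix.of v).updateRow a (Ql p)).det =
      C a 0 * (p 0 ^ 2 + p 1 ^ 2 + p 2 ^ 2) + C a 1 * p 0 + C a 2 * p 1 + C a 3 := by
    intro p a
    rw [FiveTerm.det_updateRow_fin_four, hQl]
    have e0 : (Pi.single 0 1 : Fin 4 → ℝ) = ![1, 0, 0, 0] := by ext i; fin_cases i <;> simp
    have e1 : (Pi.single 1 1 : Fin 4 → ℝ) = ![0, 1, 0, 0] := by ext i; fin_cases i <;> simp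
    have e2 : (Pi.single 2 1 : Fin 4 → ℝ) = ![0, 0, 1, 0] := by ext i; fin_cases i <;> simp
    have e3 : (Pi.single 3 1 : Fin 4 → ℝ) = ![0, 0, 0, 1] := by ext i; fin_cases i <;> simp
    simp only [hC, e0, e1, e2, e3, Matrix.cons_val_zero, Matrix.cons_val_one, Matrix.cons_val]
    ring
  have hCalg : ∀ a b, IsAlgebraic ℚ (C a b) := by
    intro a b
    apply bridge_isAlgebraic_det
    intro i j
    simp only [Matrix.updateRow_apply]
    split_ifs
    · rcases eq_or_ne j b with rfl | hjb
      · simp; exact isAlgebraic_one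
      · simp [hjb]; exact isAlgebraic_zero
    · exact hvalg i j
  have hDalg : IsAlgebraic ℚ D := bridge_isAlgebraic_det _ hvalg
  -- the data of the polytope
  let flat : Fin 4 → Bool := fun a => decide (C a 0 = 0)
  let avec : Fin 4 → Fin 3 → ℝ := fun a =>
    if C a 0 = 0 then ![D * C a 1, D * C a 2, 0] else ![-(C a 1) / (2 * C a 0), -(C a 2) / (2 * C a 0), 0]
  let cst : Fin 4 → ℝ := fun a =>
    if C a 0 = 0 then -(D * C a 3)
    else (C a 1 / (2 * C a 0)) ^ 2 + (C a 2 / (2 * C a 0)) ^ 2 - C a 3 / C a 0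
  let ε : Fin 4 → ℝ := fun a => if C a 0 = 0 then 1 else Real.sign (D * C a 0)
  refine ⟨4, flat, avec, cst, ε, ?_, ?_, ?_, ?_, ?_, hint⟩
  · intro a l
    by_cases h : C a 0 = 0
    · simp only [avec, h, if_true]
      fin_cases l
      · simpa using hDalg.mul (hCalg a 1)
      · simpa using hDalg.mul (hCalg a 2)
      · simpa using isAlgebraic_zero
    · simp only [avec, h, if_false]
      have h2 : IsAlgebraic ℚ (2 : ℝ) := by simpa using isAlgebraic_algebraMap (R := ℚ) (A := ℝ) (2 : ℚ)
      fin_cases l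
      · simpa [div_eq_mul_inv] using (hCalg a 1).neg.mul (h2.mul (hCalg a 0)).inv
      · simpa [div_eq_mul_inv] using (hCalg a 2).neg.mul (h2.mul (hCalg a 0)).inv
      · simpa using isAlgebraic_zero
  · intro a
    by_cases h : C a 0 = 0
    · simp only [cst, h, if_true]
      exact (hDalg.mul (hCalg a 3)).neg
    · simp only [cst, h, if_false]
      have h2 : IsAlgebraic ℚ (2 : ℝ) := by simpa using isAlgebraic_algebraMap (R := ℚ) (A := ℝ) (2 : ℚ)
      simp only [div_eq_mul_inv]
      exact ((((hCalg a 1).mul (h2.mul (hCalg a 0)).inv).pow 2).add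
        (((hCalg a 2).mul (h2.mul (hCalg a 0)).inv).pow 2)).sub ((hCalg a 3).mul (hCalg a 0).inv)
  · intro a
    by_cases h : C a 0 = 0
    · left; simp [ε, h]
    · simp only [ε, h, if_false]
      rcases lt_trichotomy (D * C a 0) 0 with hlt | heq | hgt
      · right; exact Real.sign_of_neg hlt
      · exact absurd heq (mul_ne_zero hdet h)
      · left; exact Real.sign_of_pos hgt
  · intro a
    by_cases h : C a 0 = 0 <;> simp [avec, h]
  · ext p
    rw [hSpx]
    simp only [mem_setOf_eq]
    refine and_congr Iff.rfl (forall_congr' fun a => ?_)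
    rw [hEC p a]
    by_cases h : C a 0 = 0
    · have e : D * (C a 0 * (p 0 ^ 2 + p 1 ^ 2 + p 2 ^ 2) + C a 1 * p 0 + C a 2 * p 1 + C a 3) =
          D * C a 1 * p 0 + D * C a 2 * p 1 + D * C a 3 := by rw [h]; ring
      rw [e]
      simp [flat, avec, cst, ε, h, Fin.sum_univ_three]
    · have hDC : D * C a 0 ≠ 0 := mul_ne_zero hdet h
      have key : D * (C a 0 * (p 0 ^ 2 + p 1 ^ 2 + p 2 ^ 2) + C a 1 * p 0 + C a 2 * p 1 + C a 3) =
          (D * C a 0) * ((p 0 + C a 1 / (2 * C a 0)) ^ 2 + (p 1 + C a 2 / (2 * C a 0)) ^ 2 + p 2 ^ 2 -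
            ((C a 1 / (2 * C a 0)) ^ 2 + (C a 2 / (2 * C a 0)) ^ 2 - C a 3 / C a 0)) := by
        field_simp
        ring
      rw [key]
      simp [flat, avec, cst, ε, h, Fin.sum_univ_three, neg_div, sub_neg_eq_add]
      rcases lt_trichotomy (D * C a 0) 0 with hlt | heq | hgt
      · rw [Real.sign_of_neg hlt]
        constructor <;> intro hh <;> nlinarith [hh, hlt]
      · exact absurd heq hDC
      · rw [Real.sign_of_pos hgt]
        constructor <;> intro hh <;> nlinarith [hh, hgt]

end Summit.KontsevichZagierPeriods.HyperbolicBloch.OffTetraSectorKernel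
end
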